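import Summits.BirchSwinnertonDyer.BirchSwinnertonDyer.Theorems.ByReductionTypeAtTwoRankOneAtTwoOffBigImageOddLocalEngineGoursatLift
import Literature.NumberTheory.EllipticCurves.BSDSelmerPConverseSerreProofs
import Literature.NumberTheory.GaloisRepresentations.AbsGaloisOuterConj
import Literature.NumberTheory.GaloisRepresentations.ModNCyclotomicCharacter
import HarnessLib

/-!
# Route `ByReductionTypeAtTwo`, crux `RankOneAtTwoOffBigImageOddLocal` (stmt-BirchSwinnertonDyer-23716), line
# `refined_kolyvagin_tamagawa_shift_at_two` — ENGINE PORT `c₀ ↦ h₀`, step E1c (regular branch): PACKAGING a regular lift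

Lead prover `prover-cruxlead-stmt-BirchSwinnertonDyer-23716-g0` (2026-08-28).  Card «ENGINE-PORT MAP (g6)» step E1 (REGULAR SUPPLY) at `Δ > 0`:
the group-level dichotomy `Engine.regular_lift_dichotomy` / `Engine.exists_regular_lift` (landed, `…EngineGoursatLift.lean`) produces — on its
regular branch — an element `g ∈ Γ_ℚ` acting on `E[2^{M+1}]` (in a frame) by the REGULAR involution `Engine.regR M = [[1,1],[0,−1]]` and on `K` like
complex conjugation `c₀`.  THIS FILE turns such a `g` into exactly the input of the landed Steps C–H
`Engine.exists_kolyvaginPrime_gt_two_of_galoisElement_regular` (`…EngineChebotarev.lean`): an element `ρ₀ ∈ Γ_K` with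
`c₀ · res ρ₀ = g`, the module involution property `g • g • P = P` on `E[2^M]` (`hsq`), the `μ`-inversion `g • ζ = ζ⁻¹` on `μ_{2^M}` (`hμ`, from
`det regR = −1` and `det ρ̄_{E,2^{M+1}} = χ_cyc` — tree `det_eq_modNCyclotomicCharacter`), and the REGULARITY witness «`g` moves a `2`-torsion point»
(the hypothesis of R1 `OffBigImageOddLocalAtTwo.cyclicTorsion_of_smul_twoTorsion_ne` and of `localKummerLossless`: LOSSLESS local Kummer maps).

* `Engine.regularSupply_of_regular_lift` — the packaging theorem.

What remains of E1c after this file: the ARITHMETIC instantiation of the dichotomy (G = Γ_ℚ, φ = the framed representation on `E[2^{M+1}]`, surjective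
by the full `2`-adic image on δ⁺; χ = restriction to `Gal(K/ℚ)`; g₀ = c₀) and the closure of its exceptional branch (`χ_K = sgn(red₂ ρ̄)·ε(χ_cyc)` forces
`K ∈ {ℚ(√±Δ), ℚ(√±2Δ)}`, excluded on the regular cells by `Δ > 0`, `K` imaginary and the two `¬ IsSquare` binders).  Nothing here proves the crux,
`BSDp W 2`, BSD or the summit; no registered stub is discharged.  BSD is not proved.

Refs: [GrossLMS1991] §3; [McCallumLMS1991] §3; [SilvermanAEC2009] III.7–III.8; Silverman in Cornell–Silverman–Stevens Ch. II §§7–8 (`det ρ̄ = χ_cyc`).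
-/

set_option linter.dupNamespace false -- tree convention: `Summit.BirchSwinnertonDyer.BirchSwinnertonDyer.Theorems` (summit = sub-problem)
set_option autoImplicit false

noncomputable section

namespace Summit.BirchSwinnertonDyer.BirchSwinnertonDyer.Theorems.OffBigImageOddLocalAtTwo.Engine

open scoped Classical MatrixGroups
open WeierstrassCurve Field Matrix
open Literature.NumberTheory.GaloisRepresentations Literature.NumberTheory.EllipticCurves

/-- **E1c (regular branch), PACKAGING.**  `e` a frame of `E[2^{M+1}]` with framed representation `ρ` (`e (σ • P) = ρ σ · e P`), `g ∈ Γ_ℚ` with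
`ρ g = regR M` (the regular involution `[[1,1],[0,−1]]`) acting on the embedded `K` like `c₀`.  Then there is `ρ₀ ∈ Γ_K` with `c₀ · res ρ₀ = g`, and
`g` squares to the identity on `E[2^M]`, inverts every `2^M`-th root of unity (`det regR = −1 = χ_cyc(g) mod 2^{M+1}`), and moves the `2`-torsion point
`e⁻¹(0, 2^M)` (`regR · (0, 2^M) = (2^M, −2^M)`).  These are the hypotheses `hsq`, `hμ` of `exists_kolyvaginPrime_gt_two_of_galoisElement_regular` and the
regularity hypothesis of R1 / `localKummerLossless`. [cite: SilvermanCSS1997, Ch. II §7 Proposition and §8] -/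
theorem regularSupply_of_regular_lift (W : WeierstrassCurve ℚ) [W.IsElliptic]
    (K : Type) [Field K] [NumberField K] (M : ℕ)
    (e : geomTorsion W ((2 ^ (M + 1) : ℕ) : ℤ) ≃+ (Fin 2 → ZMod (2 ^ (M + 1))))
    (ρ : absoluteGaloisGroup ℚ →* GL (Fin 2) (ZMod (2 ^ (M + 1))))
    (hρ : ∀ (σ : absoluteGaloisGroup ℚ) (P : geomTorsion W ((2 ^ (M + 1) : ℕ) : ℤ)),
      e (σ • P) = ((ρ σ : GL (Fin 2) (ZMod (2 ^ (M + 1)))) : Matrix (Fin 2) (Fin 2) (ZMod (2 ^ (M + 1)))) *ᵥ e P)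
    (c₀ g : absoluteGaloisGroup ℚ) (hg : ρ g = regR M)
    (hgK : ∀ x : K, g • absEmbedding ℚ K x = c₀ • absEmbedding ℚ K x) :
    ∃ ρ₀ : absoluteGaloisGroup K, c₀ * absGaloisRestrict ℚ K ρ₀ = g ∧
      (∀ P : geomTorsion W ((2 ^ M : ℕ) : ℤ), g • g • P = P) ∧
      (∀ ζ : AlgebraicClosure ℚ, ζ ^ (2 ^ M) = 1 → g • ζ = ζ⁻¹) ∧
      (∃ v : geomTorsion W 2, g • v ≠ v) := by
  haveI : NeZero (2 ^ (M + 1)) := ⟨pow_ne_zero _ two_ne_zero⟩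
  haveI : Fact (1 < 2 ^ (M + 1)) := ⟨Nat.one_lt_two_pow (Nat.succ_ne_zero M)⟩
  haveI : NeZero ((2 ^ (M + 1) : ℕ) : ℚ) := ⟨by exact_mod_cast pow_ne_zero (M + 1) two_ne_zero⟩
  -- (1) `ρ₀`: `c₀⁻¹ g` fixes the embedded `K`, hence is a restriction
  have hfix : ∀ x : K, (c₀⁻¹ * g) • absEmbedding ℚ K x = absEmbedding ℚ K x := fun x ↦ by
    rw [mul_smul, hgK, inv_smul_smul]
  obtain ⟨ρ₀, hρ₀⟩ := (mem_range_absGaloisRestrict_iff_smul_absEmbedding ℚ K (c₀⁻¹ * g)).mpr hfix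
  have hρ₀' : absGaloisRestrict ℚ K ρ₀ = c₀⁻¹ * g := hρ₀
  refine ⟨ρ₀, by rw [hρ₀', mul_inv_cancel_left], ?_, ?_, ?_⟩
  · -- (2) `g² = 1` on `E[2^{M+1}]`, hence on `E[2^M] ⊆ E[2^{M+1}]`
    intro P
    have hmem : (P : geomPoints W) ∈ geomTorsion W ((2 ^ (M + 1) : ℕ) : ℤ) := by
      rw [mem_geomTorsion_iff]
      have hP : ((2 ^ M : ℕ) : ℤ) • (P : geomPoints W) = 0 := (mem_geomTorsion_iff W _ _).mp P.2
      rw [show ((2 ^ (M + 1) : ℕ) : ℤ) = 2 * ((2 ^ M : ℕ) : ℤ) by push_cast; ring, mul_zsmul, hP, zsmul_zero]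
    set P' : geomTorsion W ((2 ^ (M + 1) : ℕ) : ℤ) := ⟨P, hmem⟩ with hP'
    have hgg : g • g • P' = P' := by
      apply e.injective
      rw [hρ, hρ, Matrix.mulVec_mulVec, ← Matrix.GeneralLinearGroup.coe_mul, ← map_mul,
        show g * g = g * g from rfl]
      have : ρ (g * g) = 1 := by rw [map_mul, hg, regR_mul_regR]
      rw [this]
      simp
    apply Subtype.ext
    have h1 : ((g • g • P' : geomTorsion W ((2 ^ (M + 1) : ℕ) : ℤ)) : geomPoints W) = g • g • (P : geomPoints W) := by
      rw [AddSubgroup.torsionBy.coe_smul, AddSubgroup.torsionBy.coe_smul]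
    have h2 : ((g • g • P : geomTorsion W ((2 ^ M : ℕ) : ℤ)) : geomPoints W) = g • g • (P : geomPoints W) := by
      rw [AddSubgroup.torsionBy.coe_smul, AddSubgroup.torsionBy.coe_smul]
    rw [h2, ← h1, hgg]
  · -- (3) `det ρ g = -1 = χ_cyc(g)`: `g` inverts `μ_{2^{M+1}}`, a fortiori `μ_{2^M}`
    intro ζ hζ
    have hζ' : ζ ^ (2 ^ (M + 1)) = 1 := by rw [pow_succ, pow_mul, hζ, one_pow]
    have hdet := det_eq_modNCyclotomicCharacter W (2 ^ (M + 1)) (by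
        calc 2 ≤ 2 ^ 1 := by norm_num
          _ ≤ 2 ^ (M + 1) := Nat.pow_le_pow_right (by norm_num) (by omega)) e g
      ((ρ g : GL (Fin 2) (ZMod (2 ^ (M + 1)))) : Matrix (Fin 2) (Fin 2) (ZMod (2 ^ (M + 1)))) (hρ g)
    rw [hg, ← Matrix.GeneralLinearGroup.val_det_apply, det_regR] at hdet
    have hspec := modNCyclotomicCharacter_spec ℚ (2 ^ (M + 1)) g ζ hζ'
    rw [hspec, ← hdet]
    -- `(-1 : ZMod (2^(M+1))).val = 2^(M+1) - 1`
    have hval : ((-1 : (ZMod (2 ^ (M + 1)))ˣ) : ZMod (2 ^ (M + 1))).val = 2 ^ (M + 1) - 1 := by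
      rw [Units.val_neg, Units.val_one, ZMod.neg_val, ZMod.val_one]
      rw [if_neg one_ne_zero]
    rw [hval]
    have hζ0 : ζ ≠ 0 := by
      rintro rfl
      rw [zero_pow (pow_ne_zero _ two_ne_zero)] at hζ
      exact zero_ne_one hζ
    rw [← mul_right_inj' (pow_ne_zero 1 hζ0), pow_one, ← pow_succ', Nat.sub_add_cancel NeZero.one_le, hζ',
      mul_inv_cancel₀ hζ0]
  · -- (4) `g` moves the `2`-torsion point `e⁻¹ (0, 2^M)`
    set c : ZMod (2 ^ (M + 1)) := ((2 ^ M : ℕ) : ZMod (2 ^ (M + 1))) with hc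
    have hc0 : c ≠ 0 := by
      rw [hc, Ne, ZMod.natCast_eq_zero_iff]
      intro hdvd
      have h1 : 2 ^ (M + 1) ≤ 2 ^ M := Nat.le_of_dvd (pow_pos two_pos M) hdvd
      have h2 : 2 ^ M < 2 ^ (M + 1) := Nat.pow_lt_pow_right (by norm_num) (by omega)
      omega
    have h2c : (2 : ZMod (2 ^ (M + 1))) * c = 0 := by
      rw [hc, show (2 : ZMod (2 ^ (M + 1))) * ((2 ^ M : ℕ) : ZMod (2 ^ (M + 1))) =
        ((2 ^ (M + 1) : ℕ) : ZMod (2 ^ (M + 1))) by push_cast; ring]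
      exact ZMod.natCast_self _
    set w : Fin 2 → ZMod (2 ^ (M + 1)) := ![0, c] with hw
    have hw0 : w 0 = 0 := by rw [hw, Matrix.cons_val_zero]
    have hw1 : w 1 = c := by rw [hw, Matrix.cons_val_one, Matrix.cons_val_zero]
    set v : geomTorsion W ((2 ^ (M + 1) : ℕ) : ℤ) := e.symm w with hv
    have hev : e v = w := by rw [hv, e.apply_symm_apply]
    have h2v : (2 : ℤ) • (v : geomPoints W) = 0 := by
      have h2w : (2 : ℤ) • w = 0 := by
        ext i
        rw [Pi.smul_apply, Pi.zero_apply, zsmul_eq_mul, Int.cast_ofNat]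
        fin_cases i
        · show (2 : ZMod (2 ^ (M + 1))) * w 0 = 0
          rw [hw0, mul_zero]
        · show (2 : ZMod (2 ^ (M + 1))) * w 1 = 0
          rw [hw1, h2c]
      have : (2 : ℤ) • v = 0 := by
        apply e.injective
        rw [map_zsmul, hev, h2w, map_zero]
      have h := congrArg Subtype.val this
      rw [AddSubgroupClass.coe_zsmul, ZeroMemClass.coe_zero] at h
      exact h
    refine ⟨⟨(v : geomPoints W), (mem_geomTorsion_iff W 2 _).mpr h2v⟩, ?_⟩
    intro hfix'
    have hgv : g • v = v := by
      have h := congrArg Subtype.val hfix'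
      rw [AddSubgroup.torsionBy.coe_smul] at h
      -- `h : g • (v : geomPoints W) = v`
      apply Subtype.ext
      rw [AddSubgroup.torsionBy.coe_smul]
      exact h
    have he : ((regR M : GL (Fin 2) (ZMod (2 ^ (M + 1)))) : Matrix (Fin 2) (Fin 2) (ZMod (2 ^ (M + 1)))) *ᵥ w = w := by
      rw [← hev, ← hg, ← hρ, hgv]
    have h0 := congr_fun he 0
    rw [Matrix.mulVec, dotProduct, Fin.sum_univ_two, val_regR, hw0, hw1] at h0
    -- `h0 : 1 * 0 + 1 * c = 0`
    simp only [Matrix.of_apply, Matrix.cons_val', Matrix.cons_val_zero, Matrix.cons_val_one,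
      Matrix.empty_val', Matrix.cons_val_fin_one, one_mul, mul_zero, zero_add] at h0
    exact hc0 h0

/-- (APPEND, lead) **The framed representation is ONTO when `ρ̄_{E,m}` is** (`HasSurjectiveModNGaloisRep W m` = surjectivity of `Γ_ℚ → Aut(E[m])`): every
`t ∈ GL₂(ℤ/m)` is `ρ(σ)` for some `σ` — transport `t` to an additive automorphism of `E[m]` along the frame, lift it, and compare matrices
on all vectors (`Matrix.ext_iff_mulVec`).  This is the hypothesis `hφ` of `Engine.regular_lift_dichotomy` on the cell δ⁺ (full `2`-adic image).
[folklore] -/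
theorem framedRep_surjective (W : WeierstrassCurve ℚ) {m : ℕ}
    (e : geomTorsion W (m : ℤ) ≃+ (Fin 2 → ZMod m))
    (ρ : absoluteGaloisGroup ℚ →* GL (Fin 2) (ZMod m))
    (hρ : ∀ (σ : absoluteGaloisGroup ℚ) (P : geomTorsion W (m : ℤ)),
      e (σ • P) = ((ρ σ : GL (Fin 2) (ZMod m)) : Matrix (Fin 2) (Fin 2) (ZMod m)) *ᵥ e P)
    (hs : W.HasSurjectiveModNGaloisRep (m : ℤ)) : Function.Surjective ρ := by
  intro t
  -- the additive automorphism of `E[m]` with matrix `t` in the frame `e`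
  let φ : geomTorsion W (m : ℤ) ≃+ geomTorsion W (m : ℤ) :=
    { toFun := fun P ↦ e.symm (((t : GL (Fin 2) (ZMod m)) : Matrix (Fin 2) (Fin 2) (ZMod m)) *ᵥ e P)
      invFun := fun P ↦ e.symm (((t⁻¹ : GL (Fin 2) (ZMod m)) : Matrix (Fin 2) (Fin 2) (ZMod m)) *ᵥ e P)
      left_inv := fun P ↦ by
        simp only [AddEquiv.apply_symm_apply, Matrix.mulVec_mulVec]
        rw [← Matrix.GeneralLinearGroup.coe_mul, inv_mul_cancel, Matrix.GeneralLinearGroup.coe_one, Matrix.one_mulVec,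
          AddEquiv.symm_apply_apply]
      right_inv := fun P ↦ by
        simp only [AddEquiv.apply_symm_apply, Matrix.mulVec_mulVec]
        rw [← Matrix.GeneralLinearGroup.coe_mul, mul_inv_cancel, Matrix.GeneralLinearGroup.coe_one, Matrix.one_mulVec,
          AddEquiv.symm_apply_apply]
      map_add' := fun P Q ↦ by
        rw [map_add, Matrix.mulVec_add, map_add] }
  obtain ⟨σ, hσ⟩ := hs (Multiplicative.ofAdd φ)
  refine ⟨σ, ?_⟩
  have hσP : ∀ P : geomTorsion W (m : ℤ), σ • P = φ P := fun P ↦ by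
    rw [← galoisRepTorsion_apply, hσ]
    rfl
  apply Units.ext
  refine Matrix.ext_iff_mulVec.mpr fun w ↦ ?_
  have h := hρ σ (e.symm w)
  rw [hσP, e.apply_symm_apply] at h
  -- `h : e (φ (e.symm w)) = ρ σ *ᵥ w`, and `e (φ (e.symm w)) = t *ᵥ w`
  have h' : e (φ (e.symm w)) = ((t : GL (Fin 2) (ZMod m)) : Matrix (Fin 2) (Fin 2) (ZMod m)) *ᵥ w := by
    show e (e.symm (((t : GL (Fin 2) (ZMod m)) : Matrix (Fin 2) (Fin 2) (ZMod m)) *ᵥ e (e.symm w))) = _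
    rw [e.apply_symm_apply, e.apply_symm_apply]
  rw [h'] at h
  exact h.symm

end Summit.BirchSwinnertonDyer.BirchSwinnertonDyer.Theorems.OffBigImageOddLocalAtTwo.Engine

end
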